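import Summits.QuantumFields.YangMills.Theorems.FluctuationComparisonRegPrIntLS2BetaNearSymmetryRigidity
import Summits.QuantumFields.YangMills.Theorems.FluctuationComparisonRegPrIntLS2BetaQuaternionicPart
import Mathlib.LinearAlgebra.Basis.VectorSpace
import HarnessLib

/-!
# S2β · seam (b) — NEAR-STABILISER RIGIDITY AT EVERY DATUM (the reducible-stratum edition of (T7a) `…S2BetaNearSymmetryRigidity`)

Cell `ym3-torus` (YM ladder rung R3 = continuum `SU(2)` Yang–Mills on the three-torus at fixed lattice data — a RUNG: NOT d = 4, NOT infinite volume,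
NOT a mass gap, NOT Clay).  Width seat `ym3-torus-px8` (gen 19), the (T)-chain of LINE g18-1 S2β, seam (b).  Crux `stmt-QuantumFields-20520`
(`…Theses.UnitScaleTilt.FluctuationComparisonRegPrIntL`); `--kind proof --supports stmt-QuantumFields-20520 --as helper`, count-neutral, DEFINITION-FREE
(0 `def`, 0 `instance`, 0 `notation`, 0 `sorry`, default heartbeats).

WHY.  Seam (b) of the (T)-chain converts pen 3's orbit growth over the regular competitors (✓`…S2BetaOrbitGrowthOfRegular.orbitGrowth_of_isCritR2_five`, a FINE
gauge transformation `u`) into growth transversal to the RESIDUAL orbit (`w↓ = 1`), which is what POS∘∕TUBE♭∕GAP♭ measure.  ✓px21 (T7a)∕(T7b) do this at an IRREDUCIBLE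
datum through NEAR-SYMMETRY RIGIDITY «a near-symmetry of `V` is sitewise near ONE scalar» (✓`exists_near_scalar_of_irr`, hypothesis IRR(V)).  At a REDUCIBLE datum
(abelian, central-holonomy, flat) the scalar is replaced by an element of the STABILISER of `V`; this file proves that replacement with NO hypothesis on the datum:

* (site algebra, sister file ✓`…S2BetaQuaternionicPart`): the quaternionic involution `c ↦ (adj c)†` of `M₂(ℂ)` (multiplicative, fixes `SU(2)`), the quaternions
  `{q | q† = adj q}` (`projMat q ∈ SU(2)`), and THE SITE ESTIMATE `‖s − projMat (½(c + (adj c)†))‖ ≤ 4·‖s − c‖` for `s ∈ SU(2)` and any `c ∈ M₂(ℂ)`.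
* §1 the commutant `C(V) = {c | c(b₋)V_b = V_b c(b₊)}` of a datum is stable under the involution and under `projMat ∘ ½(· + (adj ·)†)` — BONDWISE determinant matching
  `det q(b₋) = det (V_b q(b₊) V_b⁻¹)`, no connectivity of the lattice used — and bond relations in `SU(2)` ARE `k • V = V` (`gaugeAct_eq_self_of_comm` ∕ `comm_of_gaugeAct_eq_self`).
* §2 ★★ `exists_near_stabiliser` — NEAR-STABILISER RIGIDITY AT EVERY DATUM: `∀ V, ∃ K_V ≥ 0, ∀ s : sites → SU(2), ∃ k, k • V = V ∧ ∀ y, ‖s(y) − k(y)‖ ≤ K_V·(Σ_b dist1 ((s•V) b·(V b)⁻¹)²)^{1/2}`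
  — EVERY gauge transformation is sitewise within `K_V·d(s•V,V)` of an EXACT symmetry of `V`.  Pure finite-dimensional linear algebra: px21's anti-Lipschitz argument
  (Mathlib `LinearMap.exists_antilipschitzWith`) run on a COMPLEMENT of the commutant `ker T_V` (Mathlib `Submodule.exists_isCompl`), then the site estimate and §1; `dist1` edition
  `exists_near_stabiliser_dist1`.  ZERO hypotheses; constants per datum (existential), as POS∘ is.
CONSUMER (next pen of this seat): (T7-red) `…S2BetaPosCollarOfStabiliserLift` = ✓(T7b) `…S2BetaPosCollarAtIrreducible` with IRR(V) replaced by pen 4's LIFTING HYPOTHESIS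
`hlift : ∀ s, s • V = V → ∃ k̃, k̃ • U₀ = U₀ ∧ k̃↓ = s` (✓`…S2BetaCriticalOrbitUnique.sameOrbit_of_symmetriesLift_five` :207, verbatim): POS∘∕TUBE♭ at print's regular minimiser over ANY
datum ⟸ {`hlift`, (Lπ)_loc, ISOL∘(δ)}.

HONEST: kinematics ∕ finite-dimensional linear algebra; nothing of Bałaban's analysis; `hlift` at reducible data (px12 (B) at abelian data, flat∕central rigidity files), (Lπ)_loc
(✓px13), ISOL∘(δ), TUBE-REG∘ (datum-free δ, K-uniform μ), GAP♯∘, GAP♭, EXW∘, S2β, crux 20520 NOT proved; no summit statement is proved by a helper; finite-volume ∕ conditional;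
rung R3 = SU(2) YM₃ on T³ — NOT d = 4, NOT infinite volume, NOT a mass gap, NOT Clay; the Yang–Mills mass gap is NOT proved.  Sorry-free, axioms standard.

References: T. Bałaban, CMP **102** (1985) 277–309 [Balaban1985Variational] ((4) p.278, Thm 1 (8)–(10) p.279, Prop. 7 and (141)–(143) p.299); CMP **98** (1985) 17–51
[Balaban1985Averaging] ((8) p.19, (11)–(13) p.19, (19) p.21); CMP **99** (1985) 75–102 [Balaban1985RegularSpaces] (Thm 2 p.83, (1.29) p.81).
-/

set_option autoImplicit false

noncomputable section

namespace Summit.QuantumFields.YangMills.Theorems.FluctuationComparisonRegPrIntLS2BetaNearStabiliserRigidity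

open scoped Matrix.Norms.L2Operator ComplexOrder
open Literature.MathematicalPhysics.QuantumFieldTheory.Balaban1983to89
open Literature.MathematicalPhysics.QuantumFieldTheory.Balaban1983to89.SU2Mean (projMat projMat_of_ne projMat_of_eq)
open Summit.QuantumFields.YangMills.Theorems.FluctuationComparisonRegPrIntLS2BetaNearSymmetryRigidity (norm_comm_sub_eq_dist1)
open Summit.QuantumFields.YangMills.Theorems.FluctuationComparisonRegPrIntLS2BetaQuaternionicPart

/-! ## §1 The commutant of a datum is stable under the involution; normalised quaternionic parts of its elements are EXACT symmetries -/

section Commutant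

variable {P : Params} {j : ℕ}

/-- If `c₁·V = V·c₂` for `V ∈ SU(2)` then `(adj c₁)†·V = V·(adj c₂)†`: the bond relations defining the commutant of a datum are preserved by the quaternionic
involution (it is multiplicative and fixes `V`). [cite: Balaban1985Averaging, (8) p.19] -/
theorem star_adjugate_comm {c₁ c₂ : Matrix (Fin 2) (Fin 2) ℂ} (V : Matrix.specialUnitaryGroup (Fin 2) ℂ)
    (h : c₁ * (V : Matrix (Fin 2) (Fin 2) ℂ) = (V : Matrix (Fin 2) (Fin 2) ℂ) * c₂) :
    star (Matrix.adjugate c₁) * (V : Matrix (Fin 2) (Fin 2) ℂ) = (V : Matrix (Fin 2) (Fin 2) ℂ) * star (Matrix.adjugate c₂) := by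
  have h1 := congrArg (fun m => star (Matrix.adjugate m)) h
  simp only [star_adjugate_mul, star_adjugate_coe] at h1
  exact h1

/-- Hence the quaternionic parts satisfy the same bond relation: `½(c₁ + (adj c₁)†)·V = V·½(c₂ + (adj c₂)†)`. [cite: Balaban1985Averaging, (8) p.19] -/
theorem half_add_star_adjugate_comm {c₁ c₂ : Matrix (Fin 2) (Fin 2) ℂ} (V : Matrix.specialUnitaryGroup (Fin 2) ℂ)
    (h : c₁ * (V : Matrix (Fin 2) (Fin 2) ℂ) = (V : Matrix (Fin 2) (Fin 2) ℂ) * c₂) :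
    ((2⁻¹ : ℂ) • (c₁ + star (Matrix.adjugate c₁))) * (V : Matrix (Fin 2) (Fin 2) ℂ) =
      (V : Matrix (Fin 2) (Fin 2) ℂ) * ((2⁻¹ : ℂ) • (c₂ + star (Matrix.adjugate c₂))) := by
  rw [Matrix.smul_mul, Matrix.mul_smul, add_mul, mul_add, h, star_adjugate_comm V h]

/-- A bond relation `q₁·V = V·q₂` with `det V = 1` forces `det q₁ = det q₂` — BONDWISE, no connectivity of the lattice is used. [folklore] -/
theorem det_eq_of_comm {q₁ q₂ : Matrix (Fin 2) (Fin 2) ℂ} (V : Matrix.specialUnitaryGroup (Fin 2) ℂ)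
    (h : q₁ * (V : Matrix (Fin 2) (Fin 2) ℂ) = (V : Matrix (Fin 2) (Fin 2) ℂ) * q₂) : q₁.det = q₂.det := by
  have h1 := congrArg Matrix.det h
  rwa [Matrix.det_mul, Matrix.det_mul, (Matrix.mem_specialUnitaryGroup_iff.1 V.2).2, mul_one, one_mul] at h1

/-- Hence the NORMALISATIONS satisfy the same bond relation: `projMat q₁·V = V·projMat q₂` (both exceptional, or both scaled by the same real factor). [folklore] -/
theorem projMat_comm {q₁ q₂ : Matrix (Fin 2) (Fin 2) ℂ} (V : Matrix.specialUnitaryGroup (Fin 2) ℂ)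
    (h : q₁ * (V : Matrix (Fin 2) (Fin 2) ℂ) = (V : Matrix (Fin 2) (Fin 2) ℂ) * q₂) :
    projMat q₁ * (V : Matrix (Fin 2) (Fin 2) ℂ) = (V : Matrix (Fin 2) (Fin 2) ℂ) * projMat q₂ := by
  have hd := det_eq_of_comm V h
  by_cases h0 : q₁.det = 0
  · have h0' : q₂.det = 0 := by rw [← hd]; exact h0
    rw [projMat_of_eq h0, projMat_of_eq h0', one_mul, mul_one]
  · have h0' : q₂.det ≠ 0 := by rw [← hd]; exact h0
    rw [projMat_of_ne h0, projMat_of_ne h0', ← hd, Matrix.smul_mul, Matrix.mul_smul, h]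

/-- A sitewise family of bond relations `k(b₋)·V_b = V_b·k(b₊)` in `SU(2)` IS the statement `k • V = V`. [cite: Balaban1985Averaging, (8) p.19] -/
theorem gaugeAct_eq_self_of_comm (k : GaugeTransf P j (Matrix.specialUnitaryGroup (Fin 2) ℂ))
    (V : GaugeField P j (Matrix.specialUnitaryGroup (Fin 2) ℂ))
    (h : ∀ b : PBond P j, (k b.src : Matrix (Fin 2) (Fin 2) ℂ) * (V b : Matrix (Fin 2) (Fin 2) ℂ) =
      (V b : Matrix (Fin 2) (Fin 2) ℂ) * (k b.tgt : Matrix (Fin 2) (Fin 2) ℂ)) :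
    GaugeField.gaugeAct k V = V := by
  funext b
  apply Subtype.ext
  show (((k b.src * V b * (k b.tgt)⁻¹ : Matrix.specialUnitaryGroup (Fin 2) ℂ)) : Matrix (Fin 2) (Fin 2) ℂ) = (V b : Matrix (Fin 2) (Fin 2) ℂ)
  rw [Submonoid.coe_mul, Submonoid.coe_mul, h b, mul_assoc, ← Submonoid.coe_mul, mul_inv_cancel, OneMemClass.coe_one, mul_one]

/-- Conversely `k • V = V` gives the bond relations `k(b₋)·V_b = V_b·k(b₊)`. [cite: Balaban1985Averaging, (8) p.19] -/
theorem comm_of_gaugeAct_eq_self (k : GaugeTransf P j (Matrix.specialUnitaryGroup (Fin 2) ℂ))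
    (V : GaugeField P j (Matrix.specialUnitaryGroup (Fin 2) ℂ)) (h : GaugeField.gaugeAct k V = V) (b : PBond P j) :
    (k b.src : Matrix (Fin 2) (Fin 2) ℂ) * (V b : Matrix (Fin 2) (Fin 2) ℂ) = (V b : Matrix (Fin 2) (Fin 2) ℂ) * (k b.tgt : Matrix (Fin 2) (Fin 2) ℂ) := by
  have hb : k b.src * V b * (k b.tgt)⁻¹ = V b := congrFun h b
  have hb' : k b.src * V b = V b * k b.tgt := by
    calc k b.src * V b = k b.src * V b * (k b.tgt)⁻¹ * k b.tgt := by group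
      _ = V b * k b.tgt := by rw [hb]
  have := congrArg (fun x : Matrix.specialUnitaryGroup (Fin 2) ℂ => (x : Matrix (Fin 2) (Fin 2) ℂ)) hb'
  simpa only [Submonoid.coe_mul] using this

end Commutant

/-! ## §2 Near-stabiliser rigidity at EVERY datum (finite-dimensional linear algebra) -/

section Rigidity

variable {P : Params} {j : ℕ}

/-- ★★ **NEAR-STABILISER RIGIDITY AT EVERY DATUM — ZERO HYPOTHESES.**  For every datum `V` there is `K_V ≥ 0` such that EVERY gauge transformation `s` is, at every site,
within `K_V·d(s•V, V)` of an EXACT SYMMETRY `k` of `V` (`k • V = V`):  `‖s(y) − k(y)‖ ≤ K_V·(Σ_b dist1 ((s•V) b·(V b)⁻¹)²)^{1/2}`.  At an irreducible datum (`Stab V = {±1}`) this is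
✓px21 `…S2BetaNearSymmetryRigidity.exists_near_scalar_of_irr` up to the step `a·1 ↦ ±1`; here NO irreducibility is assumed — the reducible (abelian, central-holonomy, flat) data are covered.
Proof: the bond-commutator map `T_V s := (s(b₋)V_b − V_b s(b₊))_b` is ℂ-linear on the finite-dimensional `sites → M₂(ℂ)`; restricted to a COMPLEMENT of its kernel `C(V)` (the commutant
of the datum; Mathlib `Submodule.exists_isCompl`) it is injective, hence anti-Lipschitz (Mathlib `LinearMap.exists_antilipschitzWith`): `s = c + x`, `c ∈ C(V)`, `‖x‖ ≤ K‖T_V s‖ ≤ K·√Σdist1²`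
(✓px21 `norm_comm_sub_eq_dist1`).  The commutant is stable under the quaternionic involution `c ↦ (adj c)†` (§2), so `k := projMat ∘ ½(c + (adj c)†)` is an `SU(2)`-valued (§1
`projMat_mem_of_quat`) EXACT symmetry (§1 `projMat_comm`, bondwise determinant matching) with `‖s(y) − k(y)‖ ≤ 4‖s(y) − c(y)‖ ≤ 4K·√Σdist1²` (✓`norm_coe_sub_projMat_le`).  Constants per datum,
existential — as POS∘ is. [cite: Balaban1985Variational, (4) p.278, Prop. 7 p.299; Balaban1985Averaging, (8) p.19, (19) p.21] -/
theorem exists_near_stabiliser (V : GaugeField P j (Matrix.specialUnitaryGroup (Fin 2) ℂ)) :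
    ∃ KV : ℝ, 0 ≤ KV ∧ ∀ s : GaugeTransf P j (Matrix.specialUnitaryGroup (Fin 2) ℂ),
      ∃ k : GaugeTransf P j (Matrix.specialUnitaryGroup (Fin 2) ℂ), GaugeField.gaugeAct k V = V ∧
        ∀ y, ‖(s y : Matrix (Fin 2) (Fin 2) ℂ) - (k y : Matrix (Fin 2) (Fin 2) ℂ)‖ ≤
          KV * Real.sqrt (∑ b : PBond P j, dist1 ((GaugeField.gaugeAct s V) b * (V b)⁻¹) ^ 2) := by
  classical
  -- the bond-commutator map
  let T : (Site P j → Matrix (Fin 2) (Fin 2) ℂ) →ₗ[ℂ] (PBond P j → Matrix (Fin 2) (Fin 2) ℂ) :=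
    { toFun := fun s => fun b => s b.src * (V b : Matrix (Fin 2) (Fin 2) ℂ) - (V b : Matrix (Fin 2) (Fin 2) ℂ) * s b.tgt
      map_add' := fun s t => by
        funext b
        simp only [Pi.add_apply, add_mul, mul_add]
        abel
      map_smul' := fun c s => by
        funext b
        simp only [Pi.smul_apply, Matrix.smul_mul, Matrix.mul_smul, smul_sub, RingHom.id_apply] }
  have hT : ∀ s : Site P j → Matrix (Fin 2) (Fin 2) ℂ,
      T s = fun b => s b.src * (V b : Matrix (Fin 2) (Fin 2) ℂ) - (V b : Matrix (Fin 2) (Fin 2) ℂ) * s b.tgt := fun _ => rfl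
  -- a complement of the commutant `ker T`, and the anti-Lipschitz constant of `T` on it
  obtain ⟨Q, hQ⟩ := (LinearMap.ker T).exists_isCompl
  have hker : LinearMap.ker (T.comp Q.subtype) = ⊥ := by
    refine LinearMap.ker_eq_bot'.mpr fun x hx => ?_
    have hx1 : (x : Site P j → Matrix (Fin 2) (Fin 2) ℂ) ∈ LinearMap.ker T := hx
    have hx2 : (x : Site P j → Matrix (Fin 2) (Fin 2) ℂ) ∈ Q := x.2
    have h0 : (x : Site P j → Matrix (Fin 2) (Fin 2) ℂ) = 0 := by
      have := hQ.disjoint.le_bot (Submodule.mem_inf.mpr ⟨hx1, hx2⟩)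
      simpa using this
    exact Subtype.ext h0
  obtain ⟨Kc, _hKc, hanti⟩ := (T.comp Q.subtype).exists_antilipschitzWith hker
  refine ⟨4 * Kc, by positivity, fun s => ?_⟩
  -- decompose `s = c + x`, `c` in the commutant, `x ∈ Q`
  set sM : Site P j → Matrix (Fin 2) (Fin 2) ℂ := fun y => (s y : Matrix (Fin 2) (Fin 2) ℂ) with hsM
  have hmem : sM ∈ LinearMap.ker T ⊔ Q := by rw [hQ.sup_eq_top]; exact Submodule.mem_top
  obtain ⟨c, x, hcx⟩ := Submodule.mem_sup'.1 hmem
  have hc : ∀ b : PBond P j, (c : Site P j → Matrix (Fin 2) (Fin 2) ℂ) b.src * (V b : Matrix (Fin 2) (Fin 2) ℂ) =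
      (V b : Matrix (Fin 2) (Fin 2) ℂ) * (c : Site P j → Matrix (Fin 2) (Fin 2) ℂ) b.tgt := by
    intro b
    have h1 : T (c : Site P j → Matrix (Fin 2) (Fin 2) ℂ) = 0 := c.2
    have h2 := congrFun h1 b
    rw [hT] at h2
    exact sub_eq_zero.mp h2
  -- the symmetry `k := projMat ∘ ½(c + (adj c)†)`
  let q : Site P j → Matrix (Fin 2) (Fin 2) ℂ := fun y =>
    (2⁻¹ : ℂ) • ((c : Site P j → Matrix (Fin 2) (Fin 2) ℂ) y + star (Matrix.adjugate ((c : Site P j → Matrix (Fin 2) (Fin 2) ℂ) y)))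
  have hq : ∀ y, star (q y) = Matrix.adjugate (q y) := fun y => star_half_add_eq_adjugate _
  let k : GaugeTransf P j (Matrix.specialUnitaryGroup (Fin 2) ℂ) := fun y => ⟨projMat (q y), projMat_mem_of_quat (hq y)⟩
  have hk : ∀ y, (k y : Matrix (Fin 2) (Fin 2) ℂ) = projMat (q y) := fun _ => rfl
  refine ⟨k, ?_, fun y => ?_⟩
  · -- `k • V = V`
    refine gaugeAct_eq_self_of_comm k V fun b => ?_
    rw [hk, hk]
    exact projMat_comm (V b) (half_add_star_adjugate_comm (V b) (hc b))
  · -- the estimate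
    set S : ℝ := ∑ b : PBond P j, dist1 ((GaugeField.gaugeAct s V) b * (V b)⁻¹) ^ 2 with hS
    -- `‖T x‖ ≤ √S` (the components of `T sM = T x` are the bond commutators)
    have hTx : T (x : Site P j → Matrix (Fin 2) (Fin 2) ℂ) = T sM := by
      have h1 : T (c : Site P j → Matrix (Fin 2) (Fin 2) ℂ) = 0 := c.2
      rw [← hcx, map_add, h1, zero_add]
    have hTs : ‖T sM‖ ≤ Real.sqrt S := by
      refine (pi_norm_le_iff_of_nonneg (Real.sqrt_nonneg _)).mpr fun b => ?_
      have h1 : T sM b = (s b.src : Matrix (Fin 2) (Fin 2) ℂ) * (V b : Matrix (Fin 2) (Fin 2) ℂ) -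
          (V b : Matrix (Fin 2) (Fin 2) ℂ) * (s b.tgt : Matrix (Fin 2) (Fin 2) ℂ) := by rw [hT]
      rw [h1, norm_comm_sub_eq_dist1]
      refine Real.le_sqrt_of_sq_le ?_
      rw [hS]
      exact Finset.single_le_sum (f := fun b => dist1 ((GaugeField.gaugeAct s V) b * (V b)⁻¹) ^ 2) (fun b _ => sq_nonneg _) (Finset.mem_univ b)
    -- anti-Lipschitz on `Q`: `‖x‖ ≤ Kc‖T x‖`
    have hx : ‖(x : Site P j → Matrix (Fin 2) (Fin 2) ℂ)‖ ≤ Kc * Real.sqrt S := by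
      have h := hanti.le_mul_dist x 0
      rw [dist_zero_right, map_zero, dist_zero_right] at h
      have h2 : ‖(T.comp Q.subtype) x‖ = ‖T sM‖ := by rw [LinearMap.comp_apply, Submodule.subtype_apply, hTx]
      calc ‖(x : Site P j → Matrix (Fin 2) (Fin 2) ℂ)‖ = ‖x‖ := rfl
        _ ≤ Kc * ‖(T.comp Q.subtype) x‖ := h
        _ ≤ Kc * Real.sqrt S := by rw [h2]; exact mul_le_mul_of_nonneg_left hTs Kc.coe_nonneg
    -- sitewise: `s y − c y = x y`
    have hy : (s y : Matrix (Fin 2) (Fin 2) ℂ) - (c : Site P j → Matrix (Fin 2) (Fin 2) ℂ) y = (x : Site P j → Matrix (Fin 2) (Fin 2) ℂ) y := by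
      have h := congrFun hcx y
      simp only [Pi.add_apply] at h
      have h' : (c : Site P j → Matrix (Fin 2) (Fin 2) ℂ) y + (x : Site P j → Matrix (Fin 2) (Fin 2) ℂ) y = (s y : Matrix (Fin 2) (Fin 2) ℂ) := h
      rw [← h', add_sub_cancel_left]
    calc ‖(s y : Matrix (Fin 2) (Fin 2) ℂ) - (k y : Matrix (Fin 2) (Fin 2) ℂ)‖
        = ‖(s y : Matrix (Fin 2) (Fin 2) ℂ) - projMat (q y)‖ := by rw [hk]
      _ ≤ 4 * ‖(s y : Matrix (Fin 2) (Fin 2) ℂ) - (c : Site P j → Matrix (Fin 2) (Fin 2) ℂ) y‖ := norm_coe_sub_projMat_le (s y) _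
      _ = 4 * ‖(x : Site P j → Matrix (Fin 2) (Fin 2) ℂ) y‖ := by rw [hy]
      _ ≤ 4 * ‖(x : Site P j → Matrix (Fin 2) (Fin 2) ℂ)‖ := by gcongr; exact norm_le_pi_norm _ y
      _ ≤ 4 * (Kc * Real.sqrt S) := by gcongr
      _ = 4 * Kc * Real.sqrt S := by ring

/-- The same in `dist1` letters: `dist1 (s(y)·k(y)⁻¹) ≤ K_V·√Σ_b dist1 ((s•V) b·(V b)⁻¹)²` (`‖s − k‖ = ‖s k⁻¹ − 1‖`, unitary invariance). [cite: Balaban1985Averaging, (8) p.19, (19) p.21] -/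
theorem exists_near_stabiliser_dist1 (V : GaugeField P j (Matrix.specialUnitaryGroup (Fin 2) ℂ)) :
    ∃ KV : ℝ, 0 ≤ KV ∧ ∀ s : GaugeTransf P j (Matrix.specialUnitaryGroup (Fin 2) ℂ),
      ∃ k : GaugeTransf P j (Matrix.specialUnitaryGroup (Fin 2) ℂ), GaugeField.gaugeAct k V = V ∧
        ∀ y, dist1 (s y * (k y)⁻¹) ≤ KV * Real.sqrt (∑ b : PBond P j, dist1 ((GaugeField.gaugeAct s V) b * (V b)⁻¹) ^ 2) := by
  obtain ⟨KV, hKV, H⟩ := exists_near_stabiliser V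
  refine ⟨KV, hKV, fun s => ?_⟩
  obtain ⟨k, hkV, hk⟩ := H s
  refine ⟨k, hkV, fun y => ?_⟩
  have hkU : ((k y : Matrix.specialUnitaryGroup (Fin 2) ℂ) : Matrix (Fin 2) (Fin 2) ℂ) ∈ unitary (Matrix (Fin 2) (Fin 2) ℂ) := (k y).2.1
  have h1 : dist1 (s y * (k y)⁻¹) = ‖(s y : Matrix (Fin 2) (Fin 2) ℂ) - (k y : Matrix (Fin 2) (Fin 2) ℂ)‖ := by
    rw [SU2Mean.dist1_eq_norm, ← CStarRing.norm_mul_mem_unitary _ hkU, sub_mul, one_mul, Submonoid.coe_mul, mul_assoc, ← Submonoid.coe_mul,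
      inv_mul_cancel, OneMemClass.coe_one, mul_one]
  rw [h1]
  exact hk y

end Rigidity

end Summit.QuantumFields.YangMills.Theorems.FluctuationComparisonRegPrIntLS2BetaNearStabiliserRigidity

end
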